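import Literature.MathematicalPhysics.QuantumFieldTheory.Balaban1983to89.B2Prop31PrintedRestrictions
import Literature.MathematicalPhysics.QuantumFieldTheory.Balaban1983to89.B2Prop31UniformConstant

/-!
# `Balaban1983to89.B2Prop31PrintedUniform` — [Balaban1982Higgs2] Proposition 3.1 (3.26) p. 589 and (3.29) p. 590: THE PRINTED
QUANTIFIER *"a constant γ₀ > 0 dependent on the space dimension d and the constant a only, and independent of ε and a choice of
the sets Λ₅⁽⁰⁾, …, Λ₅⁽ᴷ⁻¹⁾ … We assume m² ≤ O(1) also"* / *"with a constant γ₀ independent of k, Λ_k"* MADE LITERAL for the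
HEAD-OF-RECORD families over the PRINTED RESTRICTIONS, `B2Prop31PrintedRestrictions.printedP31Fam` and `printed329Fam` (p23
gen 10, p310287 — the family that leads row B2.Prop3.1 `proved`): ONE constant `γ₀ = min(3a/(4(8d + 2m₁² + 4)), 1/16)`, a
function of `d`, `a` and the bound `m₁²` of the printed *"m² ≤ O(1)"* ONLY, serves BOTH conjuncts of `B2.Prop31Printed Q
(printedP31Fam Q Γ m²)` and the per-scale `B2.Ineq329Printed Q.κ₀ (printed329Fam Q Γ m²)` for EVERY `L > 1`, every
`0 < m² ≤ m₁²` (`0 ≤ m² ≤ m₁²` for (3.29)), every valid small `Γ`, every exponent `κ₀ < 2 − d/2` — hence for every `ε`, `K`,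
choice of the sets `Λ₅⁽ᵏ⁾`, cut-offs, minimizers, block fields and configuration `Φ` of the family — with the error constant
`C = γ₀·Mconst Γ d κ₀` of the gen-10 file; closing HONEST SCOPE (iv) of `B2Prop31PrintedRestrictions` (*"γ₀ depends on d, a and
on L, m² as in the precedents"*) exactly as r14's `B2Prop31UniformConstant` closed it for the general-field family `regP31Fam`

statement-level skeleton of published theorems with citation tags; proofs where landed; nothing here is a claim about the Yang–Mills mass gap

CITATION HEADER.  T. Bałaban, *(Higgs)₂,₃ quantum fields in a finite volume. II. An upper bound*, Commun. Math. Phys. **86**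
(1982) 555–594 [Balaban1982Higgs2], Prop. 3.1 (3.26) p. 589 [PDF 35] and (3.29) p. 590 [PDF 36] (PDF held
`paper:balaban1982-cmp86-higgs23-ii`, journal page = PDF page + 554; p. 589 read on the text layer `p0035.txt` and on the ×2 render
`run/shared/lean/pub/pub-balaban/b2b-balaban-ref1/pages/1982-cmp86-higgs23-II/1982-cmp86-higgs23-II-p035-x2.png`, p. 590 on
`…-p036-x2.png`); part I [Balaban1982Higgs1] (2.15) p. 609 (`a_k ↘ a(1 − L⁻²)`).  Cell `lit-balaban` (HOME
`run/shared/lean/pub/lit-balaban/`), Phase-2 proof seat **p23** gen 11 (unit `lit-balaban-p23-g11`; TAKING line HOME/STATUS.md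
2026-08-22T00:23:36Z; gen-10 HANDOFF open item (c); r14 g10 advisory HOME/lit-balaban-p23/INBOX.md 2026-08-21T22:4xZ *"under
«m² ≤ m₁²» and L ≥ 2, γ₀ := min(3a/(4(8d+2m₁²+4)), 1/16) is an L-, m²-free admissible constant … a two-line corollary if ever
wanted"*).  SKELETON rows **B2.Prop3.1** (decl of record `B2.Prop31Printed`, owner r02, head `proved p310287 · …`) and **B2.Eq3.29**
(decl of record `B2.Ineq329Printed`); second reader r14, referee ref-4.  USED BY NAME, NOTHING RESTATED: p23 g10
`B2Prop31PrintedRestrictions.{RMultiP, RMultiP.restricted, RMultiP.field, RMultiP.bondKA, RMultiP.vol, RMultiP.vol_succ,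
RMultiP.mesh_le_eps0, RMultiP.mesh_eq_pow_mul_eps, printedP31Fam, printed329Fam, hreg_of_restricted}` (p310287) and
`B2Prop31Thresholds.{Consts, Consts.Valid, SmallEps, deltaReg, thrφ, Mconst, Mconst_nonneg, small_of_thresholds,
err_le_of_thresholds, Consts.cA_nonneg, pFn_nonneg'}` (p309542); p23 g9 `B2Ineq329RegularField.{prop31_regular_tower,
ineq329_regular_concrete, l2_le_of_sup}` (p305722); r14 g10 `B2Prop31UniformConstant.{ainf_ge_three_quarters, le_gamma0_of_admissible}`
(p308589); p15 g4 `B2Prop31ZeroFieldConcrete.{gamma0, prop31_zeroField_concrete, bondK, bondK_nonneg, massK, massK_nonneg}` (p256491);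
`B2Eq328ConcretePieces.{sum_range_natExt, bond0_nonneg, mass0_nonneg}`; `B2Ineq329ZeroAveraging.mesh_eq`; `B2Eq255Concrete.barA_zero`;
b2b's `B2.Prop31Printed`, `B2.Ineq329Printed`, `B2.Params`.

WHAT IS PRINTED (verbatim, p. 589 [PDF 35]).  *"**Proposition 3.1.** There exists a constant γ₀ > 0 dependent on the space
dimension d and the constant a only, and independent of ε and a choice of the sets Λ₅⁽⁰⁾, …, Λ₅⁽ᴷ⁻¹⁾, such that for arbitrary
configurations Ã^ε, Φ defined by the formulas (3.2), (3.3), (3.24), and satisfying the restrictions given by the characteristic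
functions in (3.21), the following inequality holds"* [(3.26)] *"with κ₀ > 0. … We assume m² ≤ O(1) also. If Ã^ε = 0, then the
inequality holds without the last sum on the right side and without any restrictions on the configuration Φ."*  p. 590 [PDF 36],
after (3.29): *"with a constant γ₀ independent of k, Λ_k and for φ′_k, Ã^η satisfying suitable restrictions."*

WHY A UNIFORM CONSTANT EXISTS (two lines, as for `regP31Fam`).  The admissibility conditions for a `γ₀` in the gen-10 assembly
(`prop31_regular_tower` / `ineq329_regular_concrete`) are `0 < γ₀ ≤ 1/16` and `γ₀(8d + 2m² + 4) ≤ a(1 − L⁻²)`; p15's zero-field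
constant is `gamma0 = min(a(1 − L⁻²)/(8d + 2m²), ¼)`.  Since `L` is a natural number `> 1`, `a(1 − L⁻²) ≥ ¾a`
(`ainf_ge_three_quarters`), and `8d + 2m² + 4 ≤ 8d + 2m₁² + 4` for `m² ≤ m₁²`: `γ₀ := min(3a/(4(8d + 2m₁² + 4)), 1/16)` is
admissible for every `L`, every `m² ≤ m₁²`, and is `≤ gamma0` (`le_gamma0_of_admissible`).  The error constant never involved
`γ₀`'s dependence: it is `γ₀·Mconst Γ d κ₀` with the gen-10 `Mconst` (a function of the O(1)'s `Γ`, of `d` and of `κ₀`).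

WHAT THIS MODULE PROVES (kernel-checked, 0 `sorry`, standard axioms; theorems only — no definition, no `Prop`-valued fact).
 §1 `uniformGamma_pos`, `uniformGamma_le`, **`uniformGamma_admissible`** (the witness is admissible for every `Q` with `Q.d = d`,
    `Q.a = a`, `Q.L > 1` and every `0 ≤ m² ≤ m₁²`).
 §2 **`prop31_thresholds_clauses_of_admissible`**: for ANY `γ₀ > 0` with `γ₀(8d + 2m² + 4) ≤ a(1 − L⁻²)`, `γ₀ ≤ 1/16`, BOTH
    conjuncts of `B2.Prop31Printed Q (printedP31Fam Q Γ m²)` hold with that `γ₀` and `C = γ₀·Mconst Γ Q.d Q.κ₀` (the gen-10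
    assembly — regularity, smallness and exponent bookkeeping DERIVED from the printed thresholds — with the constant a
    parameter); `prop31Printed_thresholds_of_clauses` (repackaging into the typed decl).
 §3 **`ineq329_thresholds_clause_of_admissible`**: the same for the per-scale (3.29) family `printed329Fam` (`m² ≥ 0`);
    `ineq329Printed_thresholds_of_clause`.
 §4 **`prop31Printed_thresholds_uniform`**: `∃ γ₀ > 0` depending on `(d, a, m₁²)` only such that for every `Q : B2.Params` with
    `Q.d = d`, `Q.a = a`, `Q.L > 1`, `Q.κ₀ < 2 − d/2` (`2 ≤ d ≤ 3`), every valid `Γ` with `SmallEps`, every `0 < m² ≤ m₁²`, both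
    conjuncts hold with `γ₀` and `C = γ₀·Mconst Γ d Q.κ₀`; `prop31Printed_thresholds_uniform_explicit` (witness displayed);
    **`ineq329Printed_thresholds_uniform`** / `_explicit` (the (3.29) family, `0 ≤ m² ≤ m₁²`); `prop31Printed_thresholds'`,
    `ineq329Printed_thresholds'` (the gen-10 typed decls re-derived through the uniform constant — the two routes agree).
HONEST SCOPE.  (i) Only the QUANTIFIER ORDER of the constant is improved: `γ₀` is chosen before `L`, `m² (≤ m₁²)`, `Γ`, `κ₀`,
the lattice, the regions, the cut-offs and the fields; the dependence on the bound `m₁²` is the print's *"We assume m² ≤ O(1)"*.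
(ii) The error constant `C = γ₀·Mconst Γ d κ₀` depends on the O(1)'s `Γ = (c₃, c₄, c₅, c_θ, c_φ, e, λ, b₀, p, ε₀)` of the printed
thresholds, on `d` and on `κ₀` — print's unspecified `O((Lᵏε)^{κ₀})`; nothing about the gen-10 reading of the restrictions
(`RMultiP.restricted`, its HONEST SCOPE (i)–(iii), (v)–(vii)) is changed or derived here.  (iii) `N` (number of field components)
never entered `γ₀`.  (iv) No row head changes (owner r02); this is a fidelity complement on the head-of-record family.  Nothing
here is summit progress.
-/

noncomputable section

open Finset Real
open scoped BigOperators

namespace Literature.MathematicalPhysics.QuantumFieldTheory.Balaban1983to89.B2Prop31PrintedUniform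

open Literature.MathematicalPhysics.QuantumFieldTheory.Balaban1983to89.HiggsLattice
open Literature.MathematicalPhysics.QuantumFieldTheory.Balaban1983to89.HiggsAveraging
open Literature.MathematicalPhysics.QuantumFieldTheory.Balaban1983to89.HiggsCovariance
open Literature.MathematicalPhysics.QuantumFieldTheory.Balaban1983to89.HiggsCovariancePos
open Literature.MathematicalPhysics.QuantumFieldTheory.Balaban1983to89.B2Eq337ScalarIntegration
open Literature.MathematicalPhysics.QuantumFieldTheory.Balaban1983to89.B2Eq325ConcreteSchur
open Literature.MathematicalPhysics.QuantumFieldTheory.Balaban1983to89.B2Eq328ConcretePieces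
open Literature.MathematicalPhysics.QuantumFieldTheory.Balaban1983to89.B2Eq328DeltaK
open Literature.MathematicalPhysics.QuantumFieldTheory.Balaban1983to89.B2Ineq329ZeroAveraging
open Literature.MathematicalPhysics.QuantumFieldTheory.Balaban1983to89.B2Prop31ZeroFieldConcrete
open Literature.MathematicalPhysics.QuantumFieldTheory.Balaban1983to89.B2Eq255Concrete (barA barA_zero)
open Literature.MathematicalPhysics.QuantumFieldTheory.Balaban1983to89.B2Ineq329RegularField
open Literature.MathematicalPhysics.QuantumFieldTheory.Balaban1983to89.B2Eq324NestedRegions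
open Literature.MathematicalPhysics.QuantumFieldTheory.Balaban1983to89.B2Prop31Thresholds
open Literature.MathematicalPhysics.QuantumFieldTheory.Balaban1983to89.B2Prop31PrintedRestrictions
open Literature.MathematicalPhysics.QuantumFieldTheory.Balaban1983to89.B2Prop31UniformConstant
  (ainf_ge_three_quarters le_gamma0_of_admissible)

/-! ## §1 The witness `γ₀ = min(3a/(4(8d + 2m₁² + 4)), 1/16)` and its admissibility for every `L > 1`, `m² ≤ m₁²` -/

/-- `0 < min(3a/(4(8d + 2m₁² + 4)), 1/16)` for `a > 0`, `m₁² ≥ 0`. [cite: Balaban1982Higgs2, Prop. 3.1 p.589] -/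
theorem uniformGamma_pos (d : ℕ) {a : ℝ} (ha : 0 < a) {m1 : ℝ} (hm1 : 0 ≤ m1) :
    0 < min (3 * a / (4 * (8 * d + 2 * m1 + 4))) (1 / 16) := by
  have hD1 : 0 < 4 * (8 * (d : ℝ) + 2 * m1 + 4) := by positivity
  exact lt_min (div_pos (by linarith) hD1) (by norm_num)

/-- `min(3a/(4(8d + 2m₁² + 4)), 1/16) ≤ 1/16`. [cite: Balaban1982Higgs2, Prop. 3.1 p.589] -/
theorem uniformGamma_le (d : ℕ) (a m1 : ℝ) : min (3 * a / (4 * (8 * d + 2 * m1 + 4))) (1 / 16) ≤ 1 / 16 :=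
  min_le_right _ _

/-- **Admissibility of the witness, uniformly in `L` and in `m² ≤ m₁²`**: for every parameter record `Q` with `Q.d = d`,
`Q.a = a`, `Q.L > 1` and every `0 ≤ m² ≤ m₁²`, `γ₀(8d + 2m² + 4) ≤ ¾a ≤ a(1 − L⁻²)` ((I.2.15): `a_∞ = a(1 − L⁻²) ≥ ¾a` for a
natural number `L ≥ 2`). [cite: Balaban1982Higgs2, Prop. 3.1 p.589] [cite: Balaban1982Higgs1, (2.15) p.609] -/
theorem uniformGamma_admissible (d : ℕ) {a : ℝ} (ha : 0 < a) {m1 : ℝ} (hm1 : 0 ≤ m1)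
    (Q : B2.Params) (hQd : Q.d = d) (hQa : Q.a = a) (hQL : 1 < Q.L) {m2 : ℝ} (hm0 : 0 ≤ m2) (hm2 : m2 ≤ m1) :
    min (3 * a / (4 * (8 * d + 2 * m1 + 4))) (1 / 16) * (8 * Q.d + 2 * m2 + 4) ≤ Q.a * (1 - ((Q.L : ℝ) ^ 2)⁻¹) := by
  rw [hQd, hQa]
  have hD1 : 0 < 4 * (8 * (d : ℝ) + 2 * m1 + 4) := by positivity
  have hle1 : min (3 * a / (4 * (8 * d + 2 * m1 + 4))) (1 / 16) ≤ 3 * a / (4 * (8 * d + 2 * m1 + 4)) := min_le_left _ _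
  have hpos : 0 < 8 * (d : ℝ) + 2 * m2 + 4 := by positivity
  have hD0 : (8 * (d : ℝ) + 2 * m1 + 4) ≠ 0 := by positivity
  calc min (3 * a / (4 * (8 * d + 2 * m1 + 4))) (1 / 16) * (8 * d + 2 * m2 + 4)
      ≤ 3 * a / (4 * (8 * d + 2 * m1 + 4)) * (8 * d + 2 * m1 + 4) := by
        have : (8 * (d : ℝ) + 2 * m2 + 4) ≤ 8 * d + 2 * m1 + 4 := by linarith
        exact mul_le_mul hle1 this hpos.le (div_pos (by linarith) hD1).le
    _ = 3 * a / 4 := by rw [div_mul_eq_mul_div, mul_div_mul_right _ _ hD0]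
    _ = 3 / 4 * a := by ring
    _ ≤ a * (1 - ((Q.L : ℝ) ^ 2)⁻¹) := ainf_ge_three_quarters hQL ha.le

/-! ## §2 Both conjuncts of Proposition 3.1 on `printedP31Fam` for ANY admissible constant (the gen-10 assembly, `γ₀` a parameter) -/

/-- `Σ_{k=1}^{K} g k = Σ_{j<K} g (j+1)`. [folklore] [cite: Balaban1982Higgs2, Prop. 3.1 (3.26) p.589] -/
private theorem sum_Icc_eq_sum_fin' (K : ℕ) (g : ℕ → ℝ) : ∑ k ∈ Finset.Icc 1 K, g k = ∑ j : Fin K, g (j.val + 1) := by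
  have h : ∑ k ∈ Finset.range (K + 1), g k = g 0 + ∑ k ∈ Finset.Icc 1 K, g k := by
    rw [Finset.sum_range_eq_add_Ico _ (by omega : 0 < K + 1), Finset.Ico_add_one_right_eq_Icc]
  have h2 : ∑ k ∈ Finset.range (K + 1), g k = g 0 + ∑ j : Fin K, g (j.val + 1) := by
    rw [Finset.sum_range_succ', add_comm, Finset.sum_range]
  linarith

/-- At `Ã^ε = 0` the covariant bond sum of (3.26) is p15's zero-field bond sum `bondK` (`Ā⁽ᵏ⁾(0) = 0`, `U(0) = 1`).
[cite: Balaban1982Higgs2, Prop. 3.1 (3.26) p.589] -/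
private theorem bondSum_zero {P : HiggsLattice.Params} {N K : ℕ} (R : Regions P K) (C : ChargeData N) (j : Fin K)
    (ψ : LSite R j → V N) :
    (∑ c : HiggsLattice.PBond P (j.val + 1), if Inside (R.block j) c then
        P.mesh (j.val + 1) ^ P.d * ‖covDeriv C (barA (j.val + 1) (0 : HiggsLattice.VecField P 0)) (extL R j ψ) c‖ ^ 2
        else 0) = bondK R j ψ := by
  rw [bondK, barA_zero]
  refine Finset.sum_congr rfl fun c _ => ?_
  split_ifs
  · rw [HiggsLattice.covDeriv_zero]
  · rfl

/-- **Proposition 3.1 (3.26), both conjuncts, on the family over the PRINTED RESTRICTIONS `printedP31Fam Q Γ m²`, FOR ANY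
ADMISSIBLE CONSTANT**: if `0 < γ₀ ≤ 1/16` and `γ₀(8d + 2m² + 4) ≤ a(1 − L⁻²)` then — for `Q.L > 1`, `Q.a > 0`, `2 ≤ Q.d ≤ 3`,
`Q.κ₀ < 2 − Q.d/2`, valid `Γ` with `SmallEps` (*"ε₀ sufficiently small"*), `m² > 0` — every restricted instance satisfies (3.26)
with error `Σ_{k=1}^{K} γ₀·Mconst·(Lᵏε)^{κ₀}|Λ_k|` (the regularity of `Ã^ε` on `Bᵏ(Λ_k)`, the smallness and the exponent
bookkeeping DERIVED from the printed thresholds: `hreg_of_restricted`, `small_of_thresholds`, `err_le_of_thresholds`, then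
`prop31_regular_tower`), and every instance with `Ã^ε = 0` satisfies it without the error and without restrictions (p15's
`prop31_zeroField_concrete` and `γ₀ ≤ gamma0`).  This is p23 g10's `prop31Printed_thresholds` with the constant exposed.
[cite: Balaban1982Higgs2, Prop. 3.1 (3.26) p.589, (3.29) p.590] [cite: Balaban1983RegularityDecay, Prop. 3.1′ p.574] -/
theorem prop31_thresholds_clauses_of_admissible (Q : B2.Params) (hQL : 1 < Q.L) (hQa : 0 < Q.a) (hQd2 : 2 ≤ Q.d)
    (hQd3 : Q.d ≤ 3) (hκ : Q.κ₀ < 2 - (Q.d : ℝ) / 2) (Γ : B2Prop31Thresholds.Consts) (hΓ : Γ.Valid)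
    (hsm : SmallEps Q.d Q.L Γ) {m2 : ℝ} (hm : 0 < m2) {γ₀ : ℝ} (hγpos : 0 < γ₀)
    (hγB : γ₀ * (8 * Q.d + 2 * m2 + 4) ≤ Q.a * (1 - ((Q.L : ℝ) ^ 2)⁻¹)) (hγ16 : γ₀ ≤ 1 / 16) :
    (∀ i : RMultiP Q Γ m2, (printedP31Fam Q Γ m2 i).restricted →
      γ₀ * (∑ k ∈ range ((printedP31Fam Q Γ m2 i).K + 1), (printedP31Fam Q Γ m2 i).bond k)
          + γ₀ * (∑ k ∈ range ((printedP31Fam Q Γ m2 i).K + 1), (printedP31Fam Q Γ m2 i).mass k)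
          - (∑ k ∈ Icc 1 (printedP31Fam Q Γ m2 i).K,
              γ₀ * Mconst Γ Q.d Q.κ₀ * ((Q.L : ℝ) ^ k * (printedP31Fam Q Γ m2 i).ε) ^ Q.κ₀
                * (((printedP31Fam Q Γ m2 i).vol k : ℕ) : ℝ))
        ≤ (printedP31Fam Q Γ m2 i).form) ∧
    (∀ i : RMultiP Q Γ m2, (printedP31Fam Q Γ m2 i).zeroField →
      γ₀ * (∑ k ∈ range ((printedP31Fam Q Γ m2 i).K + 1), (printedP31Fam Q Γ m2 i).bond k)
          + γ₀ * (∑ k ∈ range ((printedP31Fam Q Γ m2 i).K + 1), (printedP31Fam Q Γ m2 i).mass k)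
        ≤ (printedP31Fam Q Γ m2 i).form) := by
  refine ⟨fun i hr => ?_, fun i hz => ?_⟩
  · -- the restricted clause (gen-10 assembly, `γ₀` a parameter)
    have hL : 1 < i.P.L := by rw [i.hL]; exact hQL
    have hd2 : 2 ≤ i.P.d := by rw [i.hd]; exact hQd2
    have hd3 : i.P.d ≤ 3 := by rw [i.hd]; exact hQd3
    have hε1 : i.P.mesh i.K ≤ 1 := i.hε₀.trans hΓ.ε₀_le_one
    have hγB' : γ₀ * (8 * i.P.d + 2 * m2 + 4) ≤ Q.a * (1 - ((i.P.L : ℝ) ^ 2)⁻¹) := by rw [i.hd, i.hL]; exact hγB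
    have hsm' : SmallEps i.P.d i.P.L Γ := by rw [i.hd, i.hL]; exact hsm
    have hκ' : Q.κ₀ < 2 - (i.P.d : ℝ) / 2 := by rw [i.hd]; exact hκ
    -- the derived inputs of `prop31_regular_tower`
    have hreg := hreg_of_restricted hΓ i hd2 hr
    have hδ : ∀ j : Fin i.K, 0 ≤ deltaReg Γ i.P.d i.P.ε (i.P.mesh (j.val + 1)) := fun j =>
      mul_nonneg (mul_nonneg (mul_nonneg (Consts.cA_nonneg hΓ) i.P.hε.le) (Real.rpow_nonneg (i.P.mesh_pos _).le _))
        (pFn_nonneg' hΓ (i.P.mesh_pos _) ((i.mesh_le_eps0 (Nat.succ_le_of_lt j.isLt)).trans hΓ.ε₀_le_one))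
    have hsmall : ∀ j : Fin i.K, 8 * (i.P.d : ℝ) ^ 4 * (i.P.L : ℝ) ^ i.P.d * i.C.e ^ 2 * i.P.mesh (j.val + 1) ^ 2 *
        ((i.P.L : ℝ) ^ (j.val + 1)) ^ 2 * deltaReg Γ i.P.d i.P.ε (i.P.mesh (j.val + 1)) ^ 2 ≤ 1 / 2 := by
      intro j
      rw [i.hCe]
      exact small_of_thresholds hΓ hd3 hsm' (i.P.mesh_pos _) (i.mesh_le_eps0 (Nat.succ_le_of_lt j.isLt))
        (i.mesh_eq_pow_mul_eps (j.val + 1))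
    obtain ⟨-, -, -, -, -, hΦ⟩ := hr
    have h := prop31_regular_tower i.T i.C i.field i.hK hε1 hQa hL hm hδ hreg hsmall hγpos.le hγB' hγ16
      (fun j => thrφ Γ i.P.d (i.P.mesh (j.val + 1))) i.Φ hΦ
    simp only [printedP31Fam]
    rw [sum_range_natExt, sum_range_natExt, sum_Icc_eq_sum_fin']
    -- the error: `Σ_j 64γ₀d³e²(Lᵏ)²δ_k²·(Ψ_k²s^d|Λ_k|) ≤ Σ_j γ₀·Mconst·(Lʲ⁺¹ε)^{κ₀}|Λ_{j+1}|`
    have herr : ∑ j : Fin i.K, 64 * γ₀ * (i.P.d : ℝ) ^ 3 * i.C.e ^ 2 * ((i.P.L : ℝ) ^ (j.val + 1)) ^ 2 *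
          deltaReg Γ i.P.d i.P.ε (i.P.mesh (j.val + 1)) ^ 2 *
          (thrφ Γ i.P.d (i.P.mesh (j.val + 1)) ^ 2 * i.P.mesh (j.val + 1) ^ i.P.d * ((i.T.regions.block j).card : ℝ))
        ≤ ∑ j : Fin i.K, γ₀ * Mconst Γ Q.d Q.κ₀ * ((Q.L : ℝ) ^ (j.val + 1) * i.P.mesh 0) ^ Q.κ₀ *
          ((i.vol (j.val + 1) : ℕ) : ℝ) := by
      refine Finset.sum_le_sum fun j _ => ?_
      rw [i.vol_succ j, ← i.hL, ← mesh_eq (j.val + 1), i.hCe]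
      have hc : 0 ≤ ((i.T.regions.block j).card : ℝ) := Nat.cast_nonneg _
      have hs1 : i.P.mesh (j.val + 1) ≤ 1 := (i.mesh_le_eps0 (Nat.succ_le_of_lt j.isLt)).trans hΓ.ε₀_le_one
      have hE := err_le_of_thresholds hΓ i.P.d hκ' (i.P.mesh_pos (j.val + 1)) hs1 (i.mesh_eq_pow_mul_eps (j.val + 1))
      have hE' : Mconst Γ i.P.d Q.κ₀ = Mconst Γ Q.d Q.κ₀ := by rw [i.hd]
      rw [hE'] at hE
      have h1 := mul_le_mul_of_nonneg_right (mul_le_mul_of_nonneg_left hE hγpos.le) hc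
      calc 64 * γ₀ * (i.P.d : ℝ) ^ 3 * Γ.e ^ 2 * ((i.P.L : ℝ) ^ (j.val + 1)) ^ 2 *
            deltaReg Γ i.P.d i.P.ε (i.P.mesh (j.val + 1)) ^ 2 *
            (thrφ Γ i.P.d (i.P.mesh (j.val + 1)) ^ 2 * i.P.mesh (j.val + 1) ^ i.P.d * ((i.T.regions.block j).card : ℝ))
          = γ₀ * (64 * (i.P.d : ℝ) ^ 3 * Γ.e ^ 2 * ((i.P.L : ℝ) ^ (j.val + 1)) ^ 2 *
            deltaReg Γ i.P.d i.P.ε (i.P.mesh (j.val + 1)) ^ 2 *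
            (thrφ Γ i.P.d (i.P.mesh (j.val + 1)) ^ 2 * i.P.mesh (j.val + 1) ^ i.P.d)) * ((i.T.regions.block j).card : ℝ) := by
            ring
        _ ≤ γ₀ * (Mconst Γ Q.d Q.κ₀ * i.P.mesh (j.val + 1) ^ Q.κ₀) * ((i.T.regions.block j).card : ℝ) := h1
        _ = γ₀ * Mconst Γ Q.d Q.κ₀ * i.P.mesh (j.val + 1) ^ Q.κ₀ * ((i.T.regions.block j).card : ℝ) := by ring
    have hb : ∀ j : Fin i.K, i.bondKA j = ∑ c : HiggsLattice.PBond i.P (j.val + 1), if Inside (i.T.regions.block j) c then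
        i.P.mesh (j.val + 1) ^ i.P.d *
          ‖covDeriv i.C (barA (j.val + 1) i.field) (extL i.T.regions j (resL i.T.regions j i.Φ)) c‖ ^ 2 else 0 :=
      fun j => rfl
    simp only [hb]
    linarith [h, herr]
  · -- the zero-field clause (p15's theorem and `γ₀ ≤ gamma0`)
    have hA : i.field = 0 := hz
    have hL : 1 < i.P.L := by rw [i.hL]; exact hQL
    have hε1 : i.P.mesh i.K ≤ 1 := i.hε₀.trans hΓ.ε₀_le_one
    have h0 := prop31_zeroField_concrete i.T.regions i.C i.T.nested_regions i.hK hε1 hQa hL hm i.Φ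
    simp only [printedP31Fam]
    rw [sum_range_natExt, sum_range_natExt]
    have hb : ∀ j : Fin i.K, i.bondKA j = bondK i.T.regions j (resL i.T.regions j i.Φ) := by
      intro j
      unfold RMultiP.bondKA
      rw [hA]
      exact bondSum_zero i.T.regions i.C j (resL i.T.regions j i.Φ)
    simp only [hb]
    rw [hA]
    have hγB' : γ₀ * (8 * i.P.d + 2 * m2 + 4) ≤ Q.a * (1 - ((i.P.L : ℝ) ^ 2)⁻¹) := by rw [i.hd, i.hL]; exact hγB
    have hle : γ₀ ≤ gamma0 i.P Q.a m2 := le_gamma0_of_admissible hm.le hγpos.le hγB' hγ16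
    have hbn : 0 ≤ bond0 i.T.regions i.C (0 : HiggsLattice.VecField i.P 0) i.Φ.1
        + ∑ j, bondK i.T.regions j (resL i.T.regions j i.Φ) :=
      add_nonneg (bond0_nonneg i.T.regions i.C _ i.Φ.1) (Finset.sum_nonneg fun j _ => bondK_nonneg i.T.regions j _)
    have hmn : 0 ≤ mass0 i.T.regions m2 i.Φ.1 + ∑ j, massK i.T.regions m2 j (resL i.T.regions j i.Φ) :=
      add_nonneg (mass0_nonneg i.T.regions hm.le i.Φ.1)
        (Finset.sum_nonneg fun j _ => massK_nonneg i.T.regions hm.le j _)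
    have h1 := mul_le_mul_of_nonneg_right hle hbn
    have h2 := mul_le_mul_of_nonneg_right hle hmn
    linarith [h0, h1, h2]

/-- Repackaging: the two clauses for an admissible `γ₀ > 0` give the cell's typed `B2.Prop31Printed Q` on `printedP31Fam Q Γ m²`
with THAT constant and `C = γ₀·Mconst Γ Q.d Q.κ₀`. [cite: Balaban1982Higgs2, Prop. 3.1 (3.26) p.589] -/
theorem prop31Printed_thresholds_of_clauses (Q : B2.Params) (hQL : 1 < Q.L) (hQa : 0 < Q.a) (hQd2 : 2 ≤ Q.d)
    (hQd3 : Q.d ≤ 3) (hκ : Q.κ₀ < 2 - (Q.d : ℝ) / 2) (Γ : B2Prop31Thresholds.Consts) (hΓ : Γ.Valid)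
    (hsm : SmallEps Q.d Q.L Γ) {m2 : ℝ} (hm : 0 < m2) {γ₀ : ℝ} (hγpos : 0 < γ₀)
    (hγB : γ₀ * (8 * Q.d + 2 * m2 + 4) ≤ Q.a * (1 - ((Q.L : ℝ) ^ 2)⁻¹)) (hγ16 : γ₀ ≤ 1 / 16) :
    B2.Prop31Printed Q (printedP31Fam Q Γ m2) := by
  obtain ⟨h1, h2⟩ := prop31_thresholds_clauses_of_admissible Q hQL hQa hQd2 hQd3 hκ Γ hΓ hsm hm hγpos hγB hγ16
  exact ⟨γ₀, γ₀ * Mconst Γ Q.d Q.κ₀, hγpos, mul_nonneg hγpos.le (Mconst_nonneg hΓ Q.d Q.κ₀), h1, h2⟩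

/-! ## §3 The per-scale (3.29) on `printed329Fam` for ANY admissible constant -/

/-- **(3.29) on the per-scale family over the PRINTED RESTRICTIONS `printed329Fam Q Γ m²`, FOR ANY ADMISSIBLE CONSTANT**: if
`0 < γ₀ ≤ 1/16` and `γ₀(8d + 2m² + 4) ≤ a(1 − L⁻²)` then — for `Q.L > 1`, `Q.a > 0`, `2 ≤ Q.d ≤ 3`, `Q.κ₀ < 2 − Q.d/2`, valid `Γ`
with `SmallEps`, `m² ≥ 0` — every restricted instance `(i, k)` satisfies
`γ₀(covDiffSq + m²s²·l2sq) − γ₀·Mconst·s^{κ₀}|Λ_k| ≤ form` (`hreg_of_restricted`, `small_of_thresholds`, `err_le_of_thresholds`, then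
`ineq329_regular_concrete`).  This is p23 g10's `ineq329Printed_thresholds` with the constant exposed.
[cite: Balaban1982Higgs2, (3.29) p.590] [cite: Balaban1983RegularityDecay, Prop. 3.1′ (1.21)–(1.22) p.574] -/
theorem ineq329_thresholds_clause_of_admissible (Q : B2.Params) (hQL : 1 < Q.L) (hQa : 0 < Q.a) (hQd2 : 2 ≤ Q.d)
    (hQd3 : Q.d ≤ 3) (hκ : Q.κ₀ < 2 - (Q.d : ℝ) / 2) (Γ : B2Prop31Thresholds.Consts) (hΓ : Γ.Valid)
    (hsm : SmallEps Q.d Q.L Γ) {m2 : ℝ} (hm : 0 ≤ m2) {γ₀ : ℝ} (hγpos : 0 < γ₀)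
    (hγB : γ₀ * (8 * Q.d + 2 * m2 + 4) ≤ Q.a * (1 - ((Q.L : ℝ) ^ 2)⁻¹)) (hγ16 : γ₀ ≤ 1 / 16) :
    ∀ ij : (Σ i : RMultiP Q Γ m2, Fin i.K), (printed329Fam Q Γ m2 ij).restricted →
      γ₀ * ((printed329Fam Q Γ m2 ij).covDiffSq
          + (printed329Fam Q Γ m2 ij).massSq * (printed329Fam Q Γ m2 ij).s ^ 2 * (printed329Fam Q Γ m2 ij).l2sq)
        - γ₀ * Mconst Γ Q.d Q.κ₀ * (printed329Fam Q Γ m2 ij).s ^ Q.κ₀ * (((printed329Fam Q Γ m2 ij).vol : ℕ) : ℝ)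
        ≤ (printed329Fam Q Γ m2 ij).form := by
  intro ij hr
  obtain ⟨i, j⟩ := ij
  have hL : 1 < i.P.L := by rw [i.hL]; exact hQL
  have hd2 : 2 ≤ i.P.d := by rw [i.hd]; exact hQd2
  have hd3 : i.P.d ≤ 3 := by rw [i.hd]; exact hQd3
  have hγB' : γ₀ * (8 * i.P.d + 2 * m2 + 4) ≤ Q.a * (1 - ((i.P.L : ℝ) ^ 2)⁻¹) := by rw [i.hd, i.hL]; exact hγB
  have hsm' : SmallEps i.P.d i.P.L Γ := by rw [i.hd, i.hL]; exact hsm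
  have hκ' : Q.κ₀ < 2 - (i.P.d : ℝ) / 2 := by rw [i.hd]; exact hκ
  have hs1 : i.P.mesh (j.val + 1) ≤ 1 := (i.mesh_le_eps0 (Nat.succ_le_of_lt j.isLt)).trans hΓ.ε₀_le_one
  have hreg := hreg_of_restricted hΓ i hd2 hr
  have hδ : 0 ≤ deltaReg Γ i.P.d i.P.ε (i.P.mesh (j.val + 1)) :=
    mul_nonneg (mul_nonneg (mul_nonneg (Consts.cA_nonneg hΓ) i.P.hε.le) (Real.rpow_nonneg (i.P.mesh_pos _).le _))
      (pFn_nonneg' hΓ (i.P.mesh_pos _) hs1)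
  have hsmall : 8 * (i.P.d : ℝ) ^ 4 * (i.P.L : ℝ) ^ i.P.d * i.C.e ^ 2 * i.P.mesh (j.val + 1) ^ 2 *
      ((i.P.L : ℝ) ^ (j.val + 1)) ^ 2 * deltaReg Γ i.P.d i.P.ε (i.P.mesh (j.val + 1)) ^ 2 ≤ 1 / 2 := by
    rw [i.hCe]
    exact small_of_thresholds hΓ hd3 hsm' (i.P.mesh_pos _) (i.mesh_le_eps0 (Nat.succ_le_of_lt j.isLt))
      (i.mesh_eq_pow_mul_eps (j.val + 1))
  obtain ⟨-, -, -, -, -, hΦ⟩ := hr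
  have h := ineq329_regular_concrete i.T.regions i.C i.hK hQa hL hm i.field j hs1 hδ (hreg j) hsmall hγpos.le hγB'
    hγ16 (resL i.T.regions j i.Φ)
  have hMψ := l2_le_of_sup i.T.regions j (resL i.T.regions j i.Φ) (hΦ j)
  simp only [printed329Fam]
  -- the mass term: `m² s² · s⁻² Σ s^d|ψ|² = massK`
  have hs0 : i.P.mesh (j.val + 1) ≠ 0 := (i.P.mesh_pos _).ne'
  have hmass : m2 * i.P.mesh (j.val + 1) ^ 2 * ((i.P.mesh (j.val + 1))⁻¹ ^ 2 *
      ∑ y : LSite i.T.regions j, i.P.mesh (j.val + 1) ^ i.P.d * ‖resL i.T.regions j i.Φ y‖ ^ 2)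
      = massK i.T.regions m2 j (resL i.T.regions j i.Φ) := by
    rw [massK, Finset.mul_sum, Finset.mul_sum]
    refine Finset.sum_congr rfl fun y _ => ?_
    field_simp
  rw [hmass]
  -- the error: `64γ₀d³e²(Lᵏ)²δ_k² Σ s^d|ψ|² ≤ γ₀·Mconst·s^{κ₀}|Λ_k|`
  have hc64 : 0 ≤ 64 * γ₀ * (i.P.d : ℝ) ^ 3 * i.C.e ^ 2 * ((i.P.L : ℝ) ^ (j.val + 1)) ^ 2 *
      deltaReg Γ i.P.d i.P.ε (i.P.mesh (j.val + 1)) ^ 2 := by positivity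
  have e1 := mul_le_mul_of_nonneg_left hMψ hc64
  have hE := err_le_of_thresholds hΓ i.P.d hκ' (i.P.mesh_pos (j.val + 1)) hs1 (i.mesh_eq_pow_mul_eps (j.val + 1))
  have hE' : Mconst Γ i.P.d Q.κ₀ = Mconst Γ Q.d Q.κ₀ := by rw [i.hd]
  rw [hE', ← i.hCe] at hE
  have e2 := mul_le_mul_of_nonneg_right (mul_le_mul_of_nonneg_left hE hγpos.le)
    (Nat.cast_nonneg (i.T.regions.block j).card)
  have e3 : 64 * γ₀ * (i.P.d : ℝ) ^ 3 * i.C.e ^ 2 * ((i.P.L : ℝ) ^ (j.val + 1)) ^ 2 *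
        deltaReg Γ i.P.d i.P.ε (i.P.mesh (j.val + 1)) ^ 2 *
        (thrφ Γ i.P.d (i.P.mesh (j.val + 1)) ^ 2 * i.P.mesh (j.val + 1) ^ i.P.d * ((i.T.regions.block j).card : ℝ))
      = γ₀ * (64 * (i.P.d : ℝ) ^ 3 * i.C.e ^ 2 * ((i.P.L : ℝ) ^ (j.val + 1)) ^ 2 *
        deltaReg Γ i.P.d i.P.ε (i.P.mesh (j.val + 1)) ^ 2 *
        (thrφ Γ i.P.d (i.P.mesh (j.val + 1)) ^ 2 * i.P.mesh (j.val + 1) ^ i.P.d)) * ((i.T.regions.block j).card : ℝ) := by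
    ring
  have hb : i.bondKA j = ∑ c : HiggsLattice.PBond i.P (j.val + 1), if Inside (i.T.regions.block j) c then
      i.P.mesh (j.val + 1) ^ i.P.d *
        ‖covDeriv i.C (barA (j.val + 1) i.field) (extL i.T.regions j (resL i.T.regions j i.Φ)) c‖ ^ 2 else 0 := rfl
  rw [hb]
  linarith [h, e1, e2, e3]

/-- Repackaging: the clause for an admissible `γ₀ > 0` gives the cell's typed `B2.Ineq329Printed Q.κ₀` on `printed329Fam Q Γ m²`
with THAT constant and `C = γ₀·Mconst Γ Q.d Q.κ₀`. [cite: Balaban1982Higgs2, (3.29) p.590] -/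
theorem ineq329Printed_thresholds_of_clause (Q : B2.Params) (hQL : 1 < Q.L) (hQa : 0 < Q.a) (hQd2 : 2 ≤ Q.d)
    (hQd3 : Q.d ≤ 3) (hκ : Q.κ₀ < 2 - (Q.d : ℝ) / 2) (Γ : B2Prop31Thresholds.Consts) (hΓ : Γ.Valid)
    (hsm : SmallEps Q.d Q.L Γ) {m2 : ℝ} (hm : 0 ≤ m2) {γ₀ : ℝ} (hγpos : 0 < γ₀)
    (hγB : γ₀ * (8 * Q.d + 2 * m2 + 4) ≤ Q.a * (1 - ((Q.L : ℝ) ^ 2)⁻¹)) (hγ16 : γ₀ ≤ 1 / 16) :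
    B2.Ineq329Printed Q.κ₀ (printed329Fam Q Γ m2) :=
  ⟨γ₀, γ₀ * Mconst Γ Q.d Q.κ₀, hγpos, mul_nonneg hγpos.le (Mconst_nonneg hΓ Q.d Q.κ₀),
    ineq329_thresholds_clause_of_admissible Q hQL hQa hQd2 hQd3 hκ Γ hΓ hsm hm hγpos hγB hγ16⟩

/-! ## §4 ONE constant for all `L`, all `m² ≤ m₁²`, all `Γ`, `κ₀`: *"dependent on … d and the constant a only"* -/

/-- **Proposition 3.1 on the printed-restrictions family with the PRINTED quantifier order of the constant, witness displayed**:
for every dimension `2 ≤ d ≤ 3`, every `a > 0` and every bound `m₁² ≥ 0` (the print's *"We assume m² ≤ O(1)"*), the ONE constant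
`γ₀ = min(3a/(4(8d + 2m₁² + 4)), 1/16)` — *"dependent on the space dimension d and the constant a only"* (and on `m₁²`) — serves,
for EVERY parameter record `Q` with `Q.d = d`, `Q.a = a`, `Q.L > 1`, `Q.κ₀ < 2 − d/2`, EVERY valid `Γ` with `SmallEps`, EVERY
`0 < m² ≤ m₁²`, both conjuncts of (3.26) on `printedP31Fam Q Γ m²` with `C = γ₀·Mconst Γ d Q.κ₀` — *"independent of ε and a
choice of the sets Λ₅⁽⁰⁾, …, Λ₅⁽ᴷ⁻¹⁾"*, of `K`, of the cut-offs, minimizers, block fields, `Φ`, and also of `L` and of the value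
of `m²`. [cite: Balaban1982Higgs2, Prop. 3.1 (3.26) p.589] -/
theorem prop31Printed_thresholds_uniform_explicit (d : ℕ) (hd2 : 2 ≤ d) (hd3 : d ≤ 3) {a : ℝ} (ha : 0 < a) {m1 : ℝ}
    (hm1 : 0 ≤ m1) (Q : B2.Params) (hQd : Q.d = d) (hQa : Q.a = a) (hQL : 1 < Q.L) (hκ : Q.κ₀ < 2 - (d : ℝ) / 2)
    (Γ : B2Prop31Thresholds.Consts) (hΓ : Γ.Valid) (hsm : SmallEps d Q.L Γ) {m2 : ℝ} (hm : 0 < m2) (hm2 : m2 ≤ m1) :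
    0 < min (3 * a / (4 * (8 * d + 2 * m1 + 4))) (1 / 16) ∧
    (∀ i : RMultiP Q Γ m2, (printedP31Fam Q Γ m2 i).restricted →
      min (3 * a / (4 * (8 * d + 2 * m1 + 4))) (1 / 16)
            * (∑ k ∈ range ((printedP31Fam Q Γ m2 i).K + 1), (printedP31Fam Q Γ m2 i).bond k)
          + min (3 * a / (4 * (8 * d + 2 * m1 + 4))) (1 / 16)
            * (∑ k ∈ range ((printedP31Fam Q Γ m2 i).K + 1), (printedP31Fam Q Γ m2 i).mass k)
          - (∑ k ∈ Icc 1 (printedP31Fam Q Γ m2 i).K,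
              min (3 * a / (4 * (8 * d + 2 * m1 + 4))) (1 / 16) * Mconst Γ d Q.κ₀
                * ((Q.L : ℝ) ^ k * (printedP31Fam Q Γ m2 i).ε) ^ Q.κ₀ * (((printedP31Fam Q Γ m2 i).vol k : ℕ) : ℝ))
        ≤ (printedP31Fam Q Γ m2 i).form) ∧
    (∀ i : RMultiP Q Γ m2, (printedP31Fam Q Γ m2 i).zeroField →
      min (3 * a / (4 * (8 * d + 2 * m1 + 4))) (1 / 16)
            * (∑ k ∈ range ((printedP31Fam Q Γ m2 i).K + 1), (printedP31Fam Q Γ m2 i).bond k)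
          + min (3 * a / (4 * (8 * d + 2 * m1 + 4))) (1 / 16)
            * (∑ k ∈ range ((printedP31Fam Q Γ m2 i).K + 1), (printedP31Fam Q Γ m2 i).mass k)
        ≤ (printedP31Fam Q Γ m2 i).form) := by
  have hγpos := uniformGamma_pos d ha hm1
  have hγB := uniformGamma_admissible d ha hm1 Q hQd hQa hQL hm.le hm2
  have hQa' : 0 < Q.a := by rw [hQa]; exact ha
  have hQd2 : 2 ≤ Q.d := by rw [hQd]; exact hd2
  have hQd3 : Q.d ≤ 3 := by rw [hQd]; exact hd3
  have hκ' : Q.κ₀ < 2 - (Q.d : ℝ) / 2 := by rw [hQd]; exact hκ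
  have hsm' : SmallEps Q.d Q.L Γ := by rw [hQd]; exact hsm
  have h := prop31_thresholds_clauses_of_admissible Q hQL hQa' hQd2 hQd3 hκ' Γ hΓ hsm' hm hγpos hγB (uniformGamma_le d a m1)
  rw [hQd] at h
  exact ⟨hγpos, h⟩

/-- **Proposition 3.1 on the printed-restrictions family with the PRINTED quantifier order of the constant** (existential form):
`∃ γ₀ > 0` depending only on `(d, a, m₁²)` serving every `L > 1`, every exponent `κ₀ < 2 − d/2`, every valid small `Γ`, every
`0 < m² ≤ m₁²` (with `C = γ₀·Mconst Γ d κ₀`), every instance of the family. [cite: Balaban1982Higgs2, Prop. 3.1 (3.26) p.589] -/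
theorem prop31Printed_thresholds_uniform (d : ℕ) (hd2 : 2 ≤ d) (hd3 : d ≤ 3) {a : ℝ} (ha : 0 < a) {m1 : ℝ} (hm1 : 0 ≤ m1) :
    ∃ γ₀ : ℝ, 0 < γ₀ ∧ ∀ (Q : B2.Params), Q.d = d → Q.a = a → 1 < Q.L → Q.κ₀ < 2 - (d : ℝ) / 2 →
      ∀ (Γ : B2Prop31Thresholds.Consts), Γ.Valid → SmallEps d Q.L Γ → ∀ (m2 : ℝ), 0 < m2 → m2 ≤ m1 →
        (∀ i : RMultiP Q Γ m2, (printedP31Fam Q Γ m2 i).restricted →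
          γ₀ * (∑ k ∈ range ((printedP31Fam Q Γ m2 i).K + 1), (printedP31Fam Q Γ m2 i).bond k)
              + γ₀ * (∑ k ∈ range ((printedP31Fam Q Γ m2 i).K + 1), (printedP31Fam Q Γ m2 i).mass k)
              - (∑ k ∈ Icc 1 (printedP31Fam Q Γ m2 i).K,
                  γ₀ * Mconst Γ d Q.κ₀ * ((Q.L : ℝ) ^ k * (printedP31Fam Q Γ m2 i).ε) ^ Q.κ₀
                    * (((printedP31Fam Q Γ m2 i).vol k : ℕ) : ℝ))
            ≤ (printedP31Fam Q Γ m2 i).form) ∧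
        (∀ i : RMultiP Q Γ m2, (printedP31Fam Q Γ m2 i).zeroField →
          γ₀ * (∑ k ∈ range ((printedP31Fam Q Γ m2 i).K + 1), (printedP31Fam Q Γ m2 i).bond k)
              + γ₀ * (∑ k ∈ range ((printedP31Fam Q Γ m2 i).K + 1), (printedP31Fam Q Γ m2 i).mass k)
            ≤ (printedP31Fam Q Γ m2 i).form) :=
  ⟨min (3 * a / (4 * (8 * d + 2 * m1 + 4))) (1 / 16), uniformGamma_pos d ha hm1,
    fun Q hQd hQa hQL hκ Γ hΓ hsm _ hm hm2 =>
      (prop31Printed_thresholds_uniform_explicit d hd2 hd3 ha hm1 Q hQd hQa hQL hκ Γ hΓ hsm hm hm2).2⟩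

/-- **(3.29) on the printed-restrictions per-scale family with the PRINTED quantifier order of the constant, witness displayed**:
*"with a constant γ₀ independent of k, Λ_k"* — and of `L`, `m² ≤ m₁²`, `Γ`, `κ₀`, `ε`, the fields: for `2 ≤ d ≤ 3`, `a > 0`,
`m₁² ≥ 0`, the constant `γ₀ = min(3a/(4(8d + 2m₁² + 4)), 1/16)` serves every `Q` with `Q.d = d`, `Q.a = a`, `Q.L > 1`,
`Q.κ₀ < 2 − d/2`, every valid `Γ` with `SmallEps`, every `0 ≤ m² ≤ m₁²`, with `C = γ₀·Mconst Γ d Q.κ₀`.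
[cite: Balaban1982Higgs2, (3.29) p.590] -/
theorem ineq329Printed_thresholds_uniform_explicit (d : ℕ) (hd2 : 2 ≤ d) (hd3 : d ≤ 3) {a : ℝ} (ha : 0 < a) {m1 : ℝ}
    (hm1 : 0 ≤ m1) (Q : B2.Params) (hQd : Q.d = d) (hQa : Q.a = a) (hQL : 1 < Q.L) (hκ : Q.κ₀ < 2 - (d : ℝ) / 2)
    (Γ : B2Prop31Thresholds.Consts) (hΓ : Γ.Valid) (hsm : SmallEps d Q.L Γ) {m2 : ℝ} (hm : 0 ≤ m2) (hm2 : m2 ≤ m1) :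
    0 < min (3 * a / (4 * (8 * d + 2 * m1 + 4))) (1 / 16) ∧
    ∀ ij : (Σ i : RMultiP Q Γ m2, Fin i.K), (printed329Fam Q Γ m2 ij).restricted →
      min (3 * a / (4 * (8 * d + 2 * m1 + 4))) (1 / 16) * ((printed329Fam Q Γ m2 ij).covDiffSq
          + (printed329Fam Q Γ m2 ij).massSq * (printed329Fam Q Γ m2 ij).s ^ 2 * (printed329Fam Q Γ m2 ij).l2sq)
        - min (3 * a / (4 * (8 * d + 2 * m1 + 4))) (1 / 16) * Mconst Γ d Q.κ₀ * (printed329Fam Q Γ m2 ij).s ^ Q.κ₀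
          * (((printed329Fam Q Γ m2 ij).vol : ℕ) : ℝ)
        ≤ (printed329Fam Q Γ m2 ij).form := by
  have hγpos := uniformGamma_pos d ha hm1
  have hγB := uniformGamma_admissible d ha hm1 Q hQd hQa hQL hm hm2
  have hQa' : 0 < Q.a := by rw [hQa]; exact ha
  have hQd2 : 2 ≤ Q.d := by rw [hQd]; exact hd2
  have hQd3 : Q.d ≤ 3 := by rw [hQd]; exact hd3
  have hκ' : Q.κ₀ < 2 - (Q.d : ℝ) / 2 := by rw [hQd]; exact hκ
  have hsm' : SmallEps Q.d Q.L Γ := by rw [hQd]; exact hsm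
  have h := ineq329_thresholds_clause_of_admissible Q hQL hQa' hQd2 hQd3 hκ' Γ hΓ hsm' hm hγpos hγB (uniformGamma_le d a m1)
  rw [hQd] at h
  exact ⟨hγpos, h⟩

/-- **(3.29) on the printed-restrictions per-scale family with the PRINTED quantifier order of the constant** (existential form).
[cite: Balaban1982Higgs2, (3.29) p.590] -/
theorem ineq329Printed_thresholds_uniform (d : ℕ) (hd2 : 2 ≤ d) (hd3 : d ≤ 3) {a : ℝ} (ha : 0 < a) {m1 : ℝ} (hm1 : 0 ≤ m1) :
    ∃ γ₀ : ℝ, 0 < γ₀ ∧ ∀ (Q : B2.Params), Q.d = d → Q.a = a → 1 < Q.L → Q.κ₀ < 2 - (d : ℝ) / 2 →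
      ∀ (Γ : B2Prop31Thresholds.Consts), Γ.Valid → SmallEps d Q.L Γ → ∀ (m2 : ℝ), 0 ≤ m2 → m2 ≤ m1 →
        ∀ ij : (Σ i : RMultiP Q Γ m2, Fin i.K), (printed329Fam Q Γ m2 ij).restricted →
          γ₀ * ((printed329Fam Q Γ m2 ij).covDiffSq
              + (printed329Fam Q Γ m2 ij).massSq * (printed329Fam Q Γ m2 ij).s ^ 2 * (printed329Fam Q Γ m2 ij).l2sq)
            - γ₀ * Mconst Γ d Q.κ₀ * (printed329Fam Q Γ m2 ij).s ^ Q.κ₀ * (((printed329Fam Q Γ m2 ij).vol : ℕ) : ℝ)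
            ≤ (printed329Fam Q Γ m2 ij).form :=
  ⟨min (3 * a / (4 * (8 * d + 2 * m1 + 4))) (1 / 16), uniformGamma_pos d ha hm1,
    fun Q hQd hQa hQL hκ Γ hΓ hsm _ hm hm2 =>
      (ineq329Printed_thresholds_uniform_explicit d hd2 hd3 ha hm1 Q hQd hQa hQL hκ Γ hΓ hsm hm hm2).2⟩

/-- p23 g10's `prop31Printed_thresholds` re-derived through the uniform constant (same statement; the two routes agree on the
typed decl of record). [cite: Balaban1982Higgs2, Prop. 3.1 (3.26) p.589] -/
theorem prop31Printed_thresholds' (Q : B2.Params) (hQL : 1 < Q.L) (hQa : 0 < Q.a) (hQd2 : 2 ≤ Q.d) (hQd3 : Q.d ≤ 3)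
    (hκ : Q.κ₀ < 2 - (Q.d : ℝ) / 2) (Γ : B2Prop31Thresholds.Consts) (hΓ : Γ.Valid) (hsm : SmallEps Q.d Q.L Γ) {m2 : ℝ}
    (hm : 0 < m2) : B2.Prop31Printed Q (printedP31Fam Q Γ m2) := by
  obtain ⟨hpos, h1, h2⟩ :=
    prop31Printed_thresholds_uniform_explicit Q.d hQd2 hQd3 hQa hm.le Q rfl rfl hQL hκ Γ hΓ hsm hm le_rfl
  exact ⟨_, _, hpos, mul_nonneg hpos.le (Mconst_nonneg hΓ Q.d Q.κ₀), h1, h2⟩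

/-- p23 g10's `ineq329Printed_thresholds` re-derived through the uniform constant (same statement).
[cite: Balaban1982Higgs2, (3.29) p.590] -/
theorem ineq329Printed_thresholds' (Q : B2.Params) (hQL : 1 < Q.L) (hQa : 0 < Q.a) (hQd2 : 2 ≤ Q.d) (hQd3 : Q.d ≤ 3)
    (hκ : Q.κ₀ < 2 - (Q.d : ℝ) / 2) (Γ : B2Prop31Thresholds.Consts) (hΓ : Γ.Valid) (hsm : SmallEps Q.d Q.L Γ) {m2 : ℝ}
    (hm : 0 ≤ m2) : B2.Ineq329Printed Q.κ₀ (printed329Fam Q Γ m2) := by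
  obtain ⟨hpos, h⟩ :=
    ineq329Printed_thresholds_uniform_explicit Q.d hQd2 hQd3 hQa hm Q rfl rfl hQL hκ Γ hΓ hsm hm le_rfl
  exact ⟨_, _, hpos, mul_nonneg hpos.le (Mconst_nonneg hΓ Q.d Q.κ₀), h⟩

end Literature.MathematicalPhysics.QuantumFieldTheory.Balaban1983to89.B2Prop31PrintedUniform

end
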